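import Summits.CriticalPhenomena.SAWScalingLimit.Theorems.SAWTotalPositivityBoundaryTP2Defs
import HarnessLib

/-!
# Crux `BoundaryTP2` (stmt-CriticalPhenomena-7115), line `Sketch`: gluing maps (width-4 pairs)

Helper for the tool stub `stub_strip4_recPair301` (W4-C4: last-column recursion of the disjoint-pair
kernel of the 4-row strip, main path to the far corner `m₃`, loop between the near corner pair
`m₀ → m₁`). Abstract setting: `G₀ ≤ G` on one vertex type `V`; `G` is `G₀` plus a *pendant column*
`m₀ m₁ m₂ m₃` hung on old vertices `p₀ p₁ p₂ p₃` (`N(m₀) ⊆ {p₀, m₁}`, `N(m₁) ⊆ {p₁, m₀, m₂}`,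
`N(m₂) ⊆ {p₂, m₁, m₃}`, `N(m₃) ⊆ {p₃, m₂}`); the edges of `G` between old vertices are edges of
`G₀`, and the edges of `G₀` end at old vertices. Two gluing maps are constructed:

* `s4r301_glueA`: `Path_{G₀}(a,p₃) ⊕ Path_{G₀}(a,p₂) ↪ Path_G(a,m₃)`, `γ₀ ↦ γ₀ · p₃ m₃`,
  `γ₀ ↦ γ₀ · p₂ m₂ m₃`, onto the paths avoiding `m₀, m₁` (a path entering `m₃` from `p₃` cannot
  pass through `m₂`, which would be a dead end: `s4r301_deadEnd`);
* `s4r301_glueB`: `Unit ⊕ (Path_{G₀}(p₀,p₁) ⊕ Path_{G₀}(p₀,p₂)) ↪ Path_G(m₀,m₁)`, the rung `m₀ m₁`,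
  `δ ↦ m₀ p₀ · δ · p₁ m₁`, `δ ↦ m₀ p₀ · δ · p₂ m₂ m₁`, onto the paths avoiding `m₃`.

Both come with their supports and lengths, so that the disjoint-pair sum over
`Path_G(a,m₃) × Path_G(m₀,m₁)` can be reparametrised (`…Strip4RecPair301`). Walk surgery by
`Walk.concat` / `Walk.transfer`; injectivity by the last-but-one vertex
(`Walk.penultimate_concat`) and cancellation of edge lists. Mathlib only. [folklore]
-/

noncomputable section

namespace Summit.CriticalPhenomena.SAWScalingLimit.Theorems.BoundaryTP2

open SimpleGraph Walk

variable {V : Type*}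

/-! ## Walk lemmas -/

/-- If every edge of `G` ends in `P`, a walk of `G` that starts in `P` stays in `P`. [folklore] -/
theorem s4r301_forall_mem_support {G : SimpleGraph V} {P : V → Prop}
    (hG : ∀ u v, G.Adj u v → P v) {u v : V} (p : G.Walk u v) (hu : P u) : ∀ z ∈ p.support, P z := by
  -- adapted from `s3p_forall_mem_support` in `…BoundaryTP2Strip3RecPair`
  induction p with
  | nil => intro z hz; rw [support_nil, List.mem_singleton] at hz; exact hz ▸ hu
  | cons h q ih =>
    intro z hz
    rw [support_cons, List.mem_cons] at hz
    rcases hz with rfl | hz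
    exacts [hu, ih (hG _ _ h) z hz]

/-- The edges of a walk of `H` whose vertices satisfy `P` lie in any graph `G` containing the
`P`-internal edges of `H`. [folklore] -/
private theorem s4r301_edges_mem_of_support {H G : SimpleGraph V} {P : V → Prop}
    (hG : ∀ u v, H.Adj u v → P u → P v → G.Adj u v) {u v : V} (p : H.Walk u v)
    (hp : ∀ z ∈ p.support, P z) : ∀ e, e ∈ p.edges → e ∈ G.edgeSet := by
  -- adapted from `s3p_edges_mem_of_support` in `…BoundaryTP2Strip3RecPair`
  induction p with
  | nil => intro e he; simp at he
  | cons h q ih =>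
    intro e he
    rw [edges_cons, List.mem_cons] at he
    rcases he with rfl | he
    · exact (mem_edgeSet G).2 (hG _ _ h (hp _ (by simp)) (hp _ (by simp)))
    · exact ih (fun z hz => hp z (by simp [hz])) e he

/-- The edges of a walk of a subgraph `G ≤ H` are edges of `H`. [folklore] -/
private theorem s4r301_edges_mem_of_le {G H : SimpleGraph V} (hle : G ≤ H) {u v : V}
    (p : G.Walk u v) : ∀ e, e ∈ p.edges → e ∈ H.edgeSet :=
  fun _ he => edgeSet_mono hle (p.edges_subset_edgeSet he)

/-- A path `p : u → w` (`u ≠ w`) is `q · (v w)` for a path `q : u → v` off `w`. [folklore] -/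
private theorem s4r301_unsnoc {H : SimpleGraph V} {u w : V} (p : H.Walk u w) (hp : p.IsPath)
    (hne : u ≠ w) :
    ∃ (v : V) (q : H.Walk u v) (h : H.Adj v w), q.IsPath ∧ w ∉ q.support ∧ p = q.concat h := by
  obtain ⟨v, h, q, hq⟩ := exists_eq_cons_of_ne hne.symm p.reverse
  have hrev := hp.reverse
  rw [hq, cons_isPath_iff] at hrev
  refine ⟨v, q.reverse, h.symm, hrev.1.reverse, fun hw => hrev.2 ?_, ?_⟩
  · rwa [support_reverse, List.mem_reverse] at hw
  · rw [← reverse_reverse p, hq, reverse_cons]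
    rfl

/-- A path of `G` all of whose vertices satisfy `P` is (the transfer of) a path of any `G₀ ≤ G`
containing the `P`-internal edges of `G`. [folklore] -/
private theorem s4r301_lift {G₀ G : SimpleGraph V} {P : V → Prop} (hle : G₀ ≤ G)
    (hold : ∀ u v, G.Adj u v → P u → P v → G₀.Adj u v) {u v : V} (q : G.Walk u v)
    (hq : q.IsPath) (hP : ∀ z ∈ q.support, P z) :
    ∃ q₀ : G₀.Walk u v, q₀.IsPath ∧ q = q₀.transfer G (s4r301_edges_mem_of_le hle q₀) := by
  refine ⟨q.transfer G₀ (s4r301_edges_mem_of_support hold q hP), hq.transfer _, ?_⟩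
  rw [transfer_transfer, transfer_self]

/-- **Dead end.** A vertex `c` off the two ends of a path, all of whose neighbours on the path are
one and the same vertex `d`, is not on the path. [folklore] -/
private theorem s4r301_deadEnd {H : SimpleGraph V} {u w c d : V} (p : H.Walk u w) (hp : p.IsPath)
    (hcu : c ≠ u) (hcw : c ≠ w) (hN : ∀ v, H.Adj c v → v ∈ p.support → v = d) :
    c ∉ p.support := by
  classical
  intro hc
  have hnodup : ((p.takeUntil c hc).append (p.dropUntil c hc)).support.Nodup := by
    rw [take_spec]; exact hp.support_nodup
  rw [support_append] at hnodup
  obtain ⟨v₁, q₁, h₁, -, -, hq₁⟩ := s4r301_unsnoc (p.takeUntil c hc) (hp.takeUntil hc) hcu.symm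
  obtain ⟨v₂, h₂, q₂, hq₂⟩ := exists_eq_cons_of_ne hcw (p.dropUntil c hc)
  have hv₁ : v₁ ∈ (p.takeUntil c hc).support := by
    rw [hq₁, support_concat]; exact List.mem_append_left _ q₁.end_mem_support
  have hv₂ : v₂ ∈ (p.dropUntil c hc).support.tail := by
    rw [hq₂, support_cons, List.tail_cons]; exact q₂.start_mem_support
  obtain rfl : v₁ = d := hN v₁ h₁.symm (p.support_takeUntil_subset_support hc hv₁)
  obtain rfl : v₂ = v₁ :=
    hN v₂ h₂ (p.support_dropUntil_subset_support hc (List.mem_of_mem_tail hv₂))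
  exact List.disjoint_of_nodup_append hnodup hv₁ hv₂

/-! ## The gluing maps (abstract pendant column `m₀ m₁ m₂ m₃` on `p₀ p₁ p₂ p₃`) -/

/-- **Gluing the main path.** `G₀ ≤ G` on one vertex type, new vertices `m₀, m₁, m₂, m₃` with
`N(m₃) ⊆ {p₃, m₂}`, `N(m₂) ⊆ {p₂, m₁, m₃}`; the edges of `G` between old vertices are edges of `G₀`,
whose edges end at old vertices. Then `γ₀ ↦ γ₀ · p₃ m₃` and `γ₀ ↦ γ₀ · p₂ m₂ m₃` form an injection
`Path_{G₀}(a,p₃) ⊕ Path_{G₀}(a,p₂) → Path_G(a,m₃)` whose range contains every path avoiding `m₀` and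
`m₁`. [folklore] -/
theorem s4r301_glueA {G₀ G : SimpleGraph V} {a p₂ p₃ m₀ m₁ m₂ m₃ : V} (hle : G₀ ≤ G)
    (hold : ∀ u v, G.Adj u v → (u ≠ m₀ ∧ u ≠ m₁ ∧ u ≠ m₂ ∧ u ≠ m₃) →
      (v ≠ m₀ ∧ v ≠ m₁ ∧ v ≠ m₂ ∧ v ≠ m₃) → G₀.Adj u v)
    (hG₀ : ∀ u v, G₀.Adj u v → v ≠ m₀ ∧ v ≠ m₁ ∧ v ≠ m₂ ∧ v ≠ m₃)
    (ha : a ≠ m₀ ∧ a ≠ m₁ ∧ a ≠ m₂ ∧ a ≠ m₃) (hp₃ : p₃ ≠ m₀ ∧ p₃ ≠ m₁ ∧ p₃ ≠ m₂ ∧ p₃ ≠ m₃)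
    (h33 : G.Adj p₃ m₃) (h22 : G.Adj p₂ m₂) (hm23 : G.Adj m₂ m₃)
    (hN3 : ∀ u, G.Adj m₃ u → u = p₃ ∨ u = m₂) (hN2 : ∀ u, G.Adj m₂ u → u = p₂ ∨ u = m₁ ∨ u = m₃) :
    ∃ e : G₀.Path a p₃ ⊕ G₀.Path a p₂ → G.Path a m₃, Function.Injective e ∧
      (∀ γ : G.Path a m₃, m₀ ∉ γ.1.support → m₁ ∉ γ.1.support → γ ∈ Set.range e) ∧
      (∀ γ₀, (e (Sum.inl γ₀)).1.support = γ₀.1.support ++ [m₃]) ∧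
      (∀ γ₀, (e (Sum.inl γ₀)).1.length = γ₀.1.length + 1) ∧
      (∀ γ₀, (e (Sum.inr γ₀)).1.support = γ₀.1.support ++ [m₂, m₃]) ∧
      (∀ γ₀, (e (Sum.inr γ₀)).1.length = γ₀.1.length + 2) := by
  have hPa : ∀ {u : V} (w : G₀.Walk a u) (z : V), z ∈ w.support →
      z ≠ m₀ ∧ z ≠ m₁ ∧ z ≠ m₂ ∧ z ≠ m₃ :=
    fun w => s4r301_forall_mem_support (P := fun z => z ≠ m₀ ∧ z ≠ m₁ ∧ z ≠ m₂ ∧ z ≠ m₃) hG₀ w ha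
  have hA : ∀ γ₀ : G₀.Path a p₃,
      ((γ₀.1.transfer G (s4r301_edges_mem_of_le hle γ₀.1)).concat h33).IsPath := fun γ₀ =>
    (γ₀.2.transfer _).concat (by rw [support_transfer]; exact fun h => (hPa γ₀.1 _ h).2.2.2 rfl) h33
  have hB : ∀ γ₀ : G₀.Path a p₂,
      (((γ₀.1.transfer G (s4r301_edges_mem_of_le hle γ₀.1)).concat h22).concat hm23).IsPath := by
    intro γ₀
    refine (IsPath.concat (γ₀.2.transfer _) ?_ h22).concat ?_ hm23
    · rw [support_transfer]; exact fun h => (hPa γ₀.1 _ h).2.2.1 rfl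
    · rw [support_concat, support_transfer, List.mem_append, List.mem_singleton, not_or]
      exact ⟨fun h => (hPa γ₀.1 _ h).2.2.2 rfl, hm23.ne'⟩
  refine ⟨Sum.elim (fun γ₀ => ⟨_, hA γ₀⟩) (fun γ₀ => ⟨_, hB γ₀⟩), ?_, ?_, fun γ₀ => ?_,
    fun γ₀ => ?_, fun γ₀ => ?_, fun γ₀ => ?_⟩
  · -- injectivity: the classes differ by the last-but-one vertex, inside a class cancel the tail
    rintro (γ₀ | γ₀) (γ₀' | γ₀') h
    · have h' := congrArg (fun γ : G.Path a m₃ => γ.1.edges) h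
      simp only [Sum.elim_inl, edges_concat, edges_transfer, List.concat_eq_append] at h'
      exact congrArg Sum.inl (Subtype.ext (edges_injective (List.append_cancel_right h')))
    · have h' := congrArg (fun γ : G.Path a m₃ => γ.1.penultimate) h
      simp only [Sum.elim_inl, Sum.elim_inr, penultimate_concat] at h'
      exact absurd h' hp₃.2.2.1
    · have h' := congrArg (fun γ : G.Path a m₃ => γ.1.penultimate) h
      simp only [Sum.elim_inl, Sum.elim_inr, penultimate_concat] at h'
      exact absurd h'.symm hp₃.2.2.1
    · have h' := congrArg (fun γ : G.Path a m₃ => γ.1.edges) h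
      simp only [Sum.elim_inr, edges_concat, edges_transfer, List.concat_eq_append,
        List.append_assoc] at h'
      exact congrArg Sum.inr (Subtype.ext (edges_injective (List.append_cancel_right h')))
  · -- the range contains the paths avoiding `m₀`, `m₁`
    intro γ h0 h1
    obtain ⟨v, q, h, hq, h3q, hγ⟩ := s4r301_unsnoc γ.1 γ.2 ha.2.2.2
    have hqγ : ∀ z ∈ q.support, z ∈ γ.1.support := fun z hz => by
      rw [hγ, support_concat]; exact List.mem_append_left _ hz
    rcases hN3 v h.symm with rfl | rfl
    · -- last step from `p₃`: `m₂` would be a dead end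
      have h2q : m₂ ∉ q.support :=
        s4r301_deadEnd q hq ha.2.2.1.symm hp₃.2.2.1.symm fun u hu huq => by
          rcases hN2 u hu with rfl | rfl | rfl
          exacts [rfl, absurd (hqγ _ huq) h1, absurd huq h3q]
      obtain ⟨γ₀, hγ₀, rfl⟩ := s4r301_lift hle hold q hq fun z hz =>
        ⟨fun e => h0 (e ▸ hqγ z hz), fun e => h1 (e ▸ hqγ z hz), fun e => h2q (e ▸ hz),
          fun e => h3q (e ▸ hz)⟩
      exact ⟨Sum.inl ⟨γ₀, hγ₀⟩, Subtype.ext hγ.symm⟩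
    · -- last step from `m₂`, entered from `p₂`
      obtain ⟨v', q', h', hq', h2q', hqq'⟩ := s4r301_unsnoc q hq ha.2.2.1
      have hq'q : ∀ z ∈ q'.support, z ∈ q.support := fun z hz => by
        rw [hqq', support_concat]; exact List.mem_append_left _ hz
      rcases hN2 v' h'.symm with rfl | rfl | rfl
      · obtain ⟨γ₀, hγ₀, rfl⟩ := s4r301_lift hle hold q' hq' fun z hz =>
          ⟨fun e => h0 (e ▸ hqγ z (hq'q z hz)), fun e => h1 (e ▸ hqγ z (hq'q z hz)),
            fun e => h2q' (e ▸ hz), fun e => h3q (e ▸ hq'q z hz)⟩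
        refine ⟨Sum.inr ⟨γ₀, hγ₀⟩, Subtype.ext ?_⟩
        change ((γ₀.transfer G _).concat h22).concat hm23 = γ.1
        rw [hγ, hqq']
      · exact absurd (hqγ _ (hq'q _ q'.end_mem_support)) h1
      · exact absurd (hq'q _ q'.end_mem_support) h3q
  · simp only [Sum.elim_inl, support_concat, support_transfer]
  · simp only [Sum.elim_inl, length_concat, length_transfer]
  · simp only [Sum.elim_inr, support_concat, support_transfer, List.append_assoc,
      List.cons_append, List.nil_append]
  · simp only [Sum.elim_inr, length_concat, length_transfer]

/-- **Gluing the loop.** Same setting, `N(m₀) ⊆ {p₀, m₁}`, `N(m₁) ⊆ {p₁, m₀, m₂}`,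
`N(m₂) ⊆ {p₂, m₁, m₃}`: the rung `m₀ m₁`, `δ ↦ m₀ p₀ · δ · p₁ m₁` and `δ ↦ m₀ p₀ · δ · p₂ m₂ m₁`
form an injection `Unit ⊕ (Path_{G₀}(p₀,p₁) ⊕ Path_{G₀}(p₀,p₂)) → Path_G(m₀,m₁)` whose range
contains every path avoiding `m₃`. [folklore] -/
theorem s4r301_glueB {V : Type*} {G₀ G : SimpleGraph V} {p₀ p₁ p₂ m₀ m₁ m₂ m₃ : V}
    (hle : G₀ ≤ G)
    (hold : ∀ u v, G.Adj u v → (u ≠ m₀ ∧ u ≠ m₁ ∧ u ≠ m₂ ∧ u ≠ m₃) →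
      (v ≠ m₀ ∧ v ≠ m₁ ∧ v ≠ m₂ ∧ v ≠ m₃) → G₀.Adj u v)
    (hG₀ : ∀ u v, G₀.Adj u v → v ≠ m₀ ∧ v ≠ m₁ ∧ v ≠ m₂ ∧ v ≠ m₃)
    (hp₀ : p₀ ≠ m₀ ∧ p₀ ≠ m₁ ∧ p₀ ≠ m₂ ∧ p₀ ≠ m₃) (hp₁ : p₁ ≠ m₀ ∧ p₁ ≠ m₁ ∧ p₁ ≠ m₂ ∧ p₁ ≠ m₃)
    (h01 : G.Adj m₀ m₁) (h00 : G.Adj m₀ p₀) (h11 : G.Adj p₁ m₁) (h22 : G.Adj p₂ m₂)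
    (hm21 : G.Adj m₂ m₁) (hm02 : m₀ ≠ m₂) (hN0 : ∀ u, G.Adj m₀ u → u = p₀ ∨ u = m₁)
    (hN1 : ∀ u, G.Adj m₁ u → u = p₁ ∨ u = m₀ ∨ u = m₂)
    (hN2 : ∀ u, G.Adj m₂ u → u = p₂ ∨ u = m₁ ∨ u = m₃) :
    ∃ e : Unit ⊕ (G₀.Path p₀ p₁ ⊕ G₀.Path p₀ p₂) → G.Path m₀ m₁, Function.Injective e ∧
      (∀ γ : G.Path m₀ m₁, m₃ ∉ γ.1.support → γ ∈ Set.range e) ∧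
      (∀ u, (e (Sum.inl u)).1.support = [m₀, m₁]) ∧ (∀ u, (e (Sum.inl u)).1.length = 1) ∧
      (∀ δ, (e (Sum.inr (Sum.inl δ))).1.support = m₀ :: (δ.1.support ++ [m₁])) ∧
      (∀ δ, (e (Sum.inr (Sum.inl δ))).1.length = δ.1.length + 2) ∧
      (∀ δ, (e (Sum.inr (Sum.inr δ))).1.support = m₀ :: (δ.1.support ++ [m₂, m₁])) ∧
      (∀ δ, (e (Sum.inr (Sum.inr δ))).1.length = δ.1.length + 3) := by
  have hPp : ∀ {u : V} (w : G₀.Walk p₀ u) (z : V), z ∈ w.support →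
      z ≠ m₀ ∧ z ≠ m₁ ∧ z ≠ m₂ ∧ z ≠ m₃ :=
    fun w => s4r301_forall_mem_support (P := fun z => z ≠ m₀ ∧ z ≠ m₁ ∧ z ≠ m₂ ∧ z ≠ m₃) hG₀ w hp₀
  have hU : (cons h01 (nil : G.Walk m₁ m₁)).IsPath := by
    rw [cons_isPath_iff, support_nil, List.mem_singleton]; exact ⟨IsPath.nil, h01.ne⟩
  have hst : ∀ {p : V} (δ : G₀.Path p₀ p),
      (cons h00 (δ.1.transfer G (s4r301_edges_mem_of_le hle δ.1))).IsPath := fun δ => by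
    rw [cons_isPath_iff, support_transfer]; exact ⟨δ.2.transfer _, fun h => (hPp δ.1 _ h).1 rfl⟩
  have hC : ∀ δ : G₀.Path p₀ p₁,
      ((cons h00 (δ.1.transfer G (s4r301_edges_mem_of_le hle δ.1))).concat h11).IsPath := by
    intro δ
    refine (hst δ).concat ?_ h11
    rw [support_cons, support_transfer, List.mem_cons, not_or]
    exact ⟨h01.ne', fun h => (hPp δ.1 _ h).2.1 rfl⟩
  have hD : ∀ δ : G₀.Path p₀ p₂,
      (((cons h00 (δ.1.transfer G (s4r301_edges_mem_of_le hle δ.1))).concat h22).concat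
        hm21).IsPath := by
    intro δ
    refine ((hst δ).concat ?_ h22).concat ?_ hm21
    · rw [support_cons, support_transfer, List.mem_cons, not_or]
      exact ⟨hm02.symm, fun h => (hPp δ.1 _ h).2.2.1 rfl⟩
    · rw [support_concat, support_cons, support_transfer, List.mem_append, List.mem_cons,
        List.mem_singleton, not_or, not_or]
      exact ⟨⟨h01.ne', fun h => (hPp δ.1 _ h).2.1 rfl⟩, hm21.ne'⟩
  refine ⟨Sum.elim (fun _ => ⟨_, hU⟩) (Sum.elim (fun δ => ⟨_, hC δ⟩) (fun δ => ⟨_, hD δ⟩)),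
    ?_, ?_, fun _ => rfl, fun _ => rfl, fun δ => ?_, fun δ => ?_, fun δ => ?_, fun δ => ?_⟩
  · -- injectivity: classes differ by length `1` or by the last-but-one vertex
    rintro (u | δ | δ) (u' | δ' | δ') h
    · exact congrArg Sum.inl (Subsingleton.elim u u')
    pick_goal 4
    · have h' := congrArg (fun γ : G.Path m₀ m₁ => γ.1.edges) h
      simp only [Sum.elim_inr, Sum.elim_inl, edges_concat, edges_cons, edges_transfer,
        List.concat_eq_append, List.cons_append, List.cons.injEq, true_and] at h'
      exact congrArg Sum.inr (congrArg Sum.inl (Subtype.ext (edges_injective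
        (List.append_cancel_right h'))))
    pick_goal 4
    · have h' := congrArg (fun γ : G.Path m₀ m₁ => γ.1.penultimate) h
      simp only [Sum.elim_inr, Sum.elim_inl, penultimate_concat] at h'
      exact absurd h' hp₁.2.2.1
    pick_goal 5
    · have h' := congrArg (fun γ : G.Path m₀ m₁ => γ.1.penultimate) h
      simp only [Sum.elim_inr, Sum.elim_inl, penultimate_concat] at h'
      exact absurd h'.symm hp₁.2.2.1
    pick_goal 5
    · have h' := congrArg (fun γ : G.Path m₀ m₁ => γ.1.edges) h
      simp only [Sum.elim_inr, edges_concat, edges_cons, edges_transfer, List.concat_eq_append,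
        List.cons_append, List.append_assoc, List.cons.injEq, true_and] at h'
      exact congrArg Sum.inr (congrArg Sum.inr (Subtype.ext (edges_injective
        (List.append_cancel_right h'))))
    all_goals
      have h' := congrArg (fun γ : G.Path m₀ m₁ => γ.1.length) h
      simp only [Sum.elim_inl, Sum.elim_inr, length_cons, length_nil, length_concat,
        length_transfer] at h'
      omega
  · -- the range contains the paths avoiding `m₃`
    intro γ h3
    obtain ⟨v, h, q, hq⟩ := exists_eq_cons_of_ne h01.ne γ.1
    have hq' := γ.2
    rw [hq, cons_isPath_iff] at hq'
    have hqγ : ∀ z ∈ q.support, z ∈ γ.1.support := fun z hz => by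
      rw [hq, support_cons]; exact List.mem_cons_of_mem _ hz
    rcases hN0 v h with rfl | rfl
    · -- first step to `p₀`; the last step comes from `p₁` or from `m₂`
      obtain ⟨v', q', h', hp', h1q', hqq'⟩ := s4r301_unsnoc q hq'.1 hp₀.2.1
      have hq'q : ∀ z ∈ q'.support, z ∈ q.support := fun z hz => by
        rw [hqq', support_concat]; exact List.mem_append_left _ hz
      rcases hN1 v' h'.symm with rfl | rfl | rfl
      · have h2q' : m₂ ∉ q'.support :=
          s4r301_deadEnd q' hp' hp₀.2.2.1.symm hp₁.2.2.1.symm fun u hu huq => by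
            rcases hN2 u hu with rfl | rfl | rfl
            exacts [rfl, absurd huq h1q', absurd (hqγ _ (hq'q _ huq)) h3]
        obtain ⟨δ, hδ, rfl⟩ := s4r301_lift hle hold q' hp' fun z hz =>
          ⟨fun e => hq'.2 (e ▸ hq'q z hz), fun e => h1q' (e ▸ hz), fun e => h2q' (e ▸ hz),
            fun e => h3 (e ▸ hqγ z (hq'q z hz))⟩
        refine ⟨Sum.inr (Sum.inl ⟨δ, hδ⟩), Subtype.ext ?_⟩
        change (cons h00 (δ.transfer G _)).concat h11 = γ.1
        rw [hq, hqq']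
        rfl
      · exact absurd (hq'q _ q'.end_mem_support) hq'.2
      · obtain ⟨v'', q'', h'', hp'', h2q'', hqr⟩ := s4r301_unsnoc q' hp' hp₀.2.2.1
        have hq''q' : ∀ z ∈ q''.support, z ∈ q'.support := fun z hz => by
          rw [hqr, support_concat]; exact List.mem_append_left _ hz
        rcases hN2 v'' h''.symm with rfl | rfl | rfl
        · obtain ⟨δ, hδ, rfl⟩ := s4r301_lift hle hold q'' hp'' fun z hz =>
            ⟨fun e => hq'.2 (e ▸ hq'q z (hq''q' z hz)), fun e => h1q' (e ▸ hq''q' z hz),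
              fun e => h2q'' (e ▸ hz), fun e => h3 (e ▸ hqγ z (hq'q z (hq''q' z hz)))⟩
          refine ⟨Sum.inr (Sum.inr ⟨δ, hδ⟩), Subtype.ext ?_⟩
          change ((cons h00 (δ.transfer G _)).concat h22).concat hm21 = γ.1
          rw [hq, hqq', hqr]
          rfl
        · exact absurd (hq''q' _ q''.end_mem_support) h1q'
        · exact absurd (hqγ _ (hq'q _ (hq''q' _ q''.end_mem_support))) h3
    · -- first step to `m₁`: the rung
      have hqnil : q = nil := eq_nil_iff_nil.2 (isPath_iff_nil.1 hq'.1)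
      refine ⟨Sum.inl (), Subtype.ext ?_⟩
      change cons h01 nil = γ.1
      rw [hq, hqnil]
  · simp only [Sum.elim_inr, Sum.elim_inl, support_concat, support_cons, support_transfer,
      List.cons_append]
  · simp only [Sum.elim_inr, Sum.elim_inl, length_concat, length_cons, length_transfer]
  · simp only [Sum.elim_inr, support_concat, support_cons, support_transfer, List.cons_append,
      List.append_assoc, List.nil_append]
  · simp only [Sum.elim_inr, length_concat, length_cons, length_transfer]

end Summit.CriticalPhenomena.SAWScalingLimit.Theorems.BoundaryTP2
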